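import Literature.MathematicalPhysics.QuantumFieldTheory.Balaban1983to89.B8Ineq130Rec
import Literature.MathematicalPhysics.QuantumFieldTheory.Balaban1983to89.B7SectEFLinearisationRec

/-!
# `Balaban1983to89.B8Eq119TwistedAxialRec` — [Balaban1985RegularSpaces] (1.15)∕(1.19)∕(1.29): the axial classes `Ax_k(ℭ, 1)`, `Ax_k(ℭ, U₀)` and the restriction
# (1.29) «(R̄₀uʲ)(y) = 1» TYPED FOR THE RECORD's symmetric block averaging [Balaban1987RG1] (0.4) (`avgIterZ`; CENTRED blocks, contours from the
# block centres) — the definition twins `UnderZ`, `InAxOneZ`, `InAxZ`, `Restr129Z` (+ `bgTZ_one`) of the [6] Sect. A octet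

statement-level skeleton of published theorems with citation tags; proofs where landed; nothing here is a claim about the Yang–Mills mass gap

CITATION HEADER.  [6] = T. Bałaban, *Spaces of regular gauge field configurations on a lattice and gauge fixing conditions*, Commun. Math. Phys. **99**
(1985) 75–102 [Balaban1985RegularSpaces]: p. 78 (1.15); p. 79: *«for x₀ ∈ Bʲ(x_j), x_j ∈ Λ_j, 1 ≤ j ≤ k, we define a sequence of points x₀, x₁, …, x_{j−1},
x_j by the conditions x_n ∈ B(x_{n+1}), n = 0, 1, …, j − 1, and we put (R̄ⁿ_{0,x_{n+1}} Ũ′ⁿ)(Γ_{x_{n+1},x_n}) = ∏_{b⊂Γ_{x_{n+1},x_n}} R(Ū₀ⁿ(Γ_{x_{n+1},b₋})) Ũ′ⁿ_b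
= 1. (1.19) … The conditions (1.19) determine uniquely an element in each orbit … We denote this gauge condition by Ax_k(𝔅_k, U₀).»*; p. 81 (1.29) *«(\overline{R₀u}ʲ)(y)
= 1 for y ∈ Λ_j, j = 0, 1, …, k»*; p. 99 (1.132) (`Ax_k(ℭ_k, 1)`).  [I] = [Balaban1987RG1] (0.3)–(0.4) pp. 252–253; [3] = [Balaban1985Averaging] (78)–(80) p. 30.
Cell `pub-ymgap`, seat `pub-ymgap-dag-n05-d` g23 — «N05-REC» road, item R2 (LEAD PEN dag-n05-e; word I.45179 (q1): «YOU type the [6] Sect. A definition twins … as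
centre-based SIGNED-treeWord texts; POINT 2 ADOPTED in the `inAx_iff` form»; TOKEN RULE (T1) `avgIter ↦ avgIterZ`, (T2) centred blocks `L•z + offZ L r`, `Under ↦
UnderZ` (`|z_i − Lᵐx_i| ≤ ctrShift L m`), (T3) contours = the engine's `axialFn`, (T5)∕(q1) engine names `+Z` for definitions).  Twins of `B8Ineq132.Under ∕
InAxOne ∕ inAxOne_of_tower`, `B8Eq119TwistedAxial.InAx ∕ inAx_iff ∕ inAx_one_iff ∕ inAx_self ∕ inAx_of_global ∕ inAx_of_tower ∕ bgT_one ∕ Restr129 ∕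
restr129_level_zero ∕ restr129_one_iff`; `bgTZ` and the centred `Blocking` `zdBlockingZ` are dag-n05-e's (`B7SectEFLinearisationRec` §9, p691879).
`--kind definition --supports stmt-QuantumFields-20541` (K0⁷; count-neutral).

POINT 2 (located on the cell bus 2026-08-29, adopted by the LEAD PEN): print's (1.19) is an ordered product over FORWARD bonds (the engine's `covProd`, corner
blocks); from the CENTRE the block trees have backward bonds, so `InAxZ` is stated directly in the transporter form `W̄ⁿ(Γ_{L•z,x}) = Ū₀ⁿ(Γ_{L•z,x})` — the form
`B8Eq119TwistedAxial.inAx_iff` to which every consumer rewrites ((1.19) ⟺ it by `covProd_eq_one_iff` in the engine).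

WHAT IS DEFINED ∕ PROVED (sorry-free).  §1 `UnderZ L m x z` («z ∈ Bᵐ(x)», centred: `|z_i − Lᵐx_i| ≤ ctrShift L m`), `underZ_zero_iff`, `underZ_one_iff_inBlock`,
`underZ_succ_of_underZ_block`, `underZ_tower` (a site under `x ∈ □̃^{(j)}` lies in `□̃^{(j−m)}` — centred tower of `B8Ineq130Rec`).  §1b `ctrShift_add` (`c_{n+p} =
Lᵖc_n + c_p`), the centred floor `flmZ L m` (`⌊(x + c_m)∕Lᵐ⌋`), `underZ_flmZ`, `underZ_iff_flmZ_eq` (the block is unique), `fl_eq_flmZ_one`, ★`iterate_fl_eq_flmZ` (`(fl L)^[j] = flmZ L j`: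
nested centred blocks), ★`mem_blockSitesZ_pow_iff` (dag-n05-e's `blockSitesZ (Lʲ) y` IS `Bʲ(y)`), `mem_blockSitesZ_pow_iff_flmZ`.  §2 `InAxOneZ` (= (1.15)∕(1.132)'s
`Ax_k(ℭ, 1)`), `inAxOneZ_of_tower`.  §3 `InAxZ` (= (1.19)'s `Ax_k(ℭ, U₀)` in transporter form), `inAxZ_iff` (`Iff.rfl`), `inAxZ_one_iff`, `inAxZ_self`,
`inAxZ_of_global`, `inAxZ_of_tower`.  §4 `bgTZ_one`, `Restr129Z` (= (1.29) with [3] (79)–(80) `Rbar (zdBlockingZ d L) (bgTZ L U₀)`), `restr129Z_level_zero`,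
`restr129Z_one_iff`.
HONEST SCOPE.  Definitions + bookkeeping; nothing of [3]∕[6]∕[I] asserted; `HThm4Rec` UNDISCHARGED; N05 ∕ N07 NOT discharged; counts unmoved; one finite 𝕋⁴
programme at fixed ε — nothing continuum ∕ ℝ⁴ ∕ OS ∕ mass gap ∕ Clay.  No `instance`, no `notation`, no `sorry`.
-/

noncomputable section

open scoped BigOperators

namespace Literature.MathematicalPhysics.QuantumFieldTheory.Balaban1983to89.B8Eq119TwistedAxialRec

open B7Prop1Explicit BlockAveragingZd B8Lemma1NonAbelianRecLoops B8Ineq130Rec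
open B7Eq78Linearization (Rbar Rbar_zero)
open B7SectEFLinearisationRec (zdBlockingZ bgTZ bgTZ_apply)
open B8Ineq130 (axialFn_one)

-- `Site` alone would resolve to the torus sites of `Setup.lean`; re-export the `ℤᵈ` sites of `B7Prop1Explicit`.
export B7Prop1Explicit (Site)

variable {d : ℕ}

/-! ## §1 «`z ∈ Bᵐ(x)`» for CENTRED blocks -/

/-- **«`z ∈ Bᵐ(x)`», CENTRED** (p. 79 «x₀ ∈ Bʲ(x_j)»; [I] p. 252 «a block … with a center at y»): the site `z` of the `m`-times finer lattice lies in the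
`m`-fold centred block of `x`, `Lᵐx + [−s_m, s_m]ᵈ`, `s_m = ctrShift L m = (Lᵐ−1)∕2` (engine: `B8Ineq132.Under`, corner blocks `Lᵐx + [0, Lᵐ)ᵈ`).
[cite: Balaban1985RegularSpaces, (1.19) p.79; Balaban1987RG1, (0.3) p.252] -/
def UnderZ (L m : ℕ) (x z : Site d) : Prop :=
  ∀ i, -(ctrShift L m : ℤ) ≤ z i - (L : ℤ) ^ m * x i ∧ z i - (L : ℤ) ^ m * x i ≤ ctrShift L m

/-- Depth `0`: `z ∈ B⁰(x) ↔ z = x`. [cite: Balaban1985RegularSpaces, (1.19) p.79 (bookkeeping)] -/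
theorem underZ_zero_iff (L : ℕ) (x z : Site d) : UnderZ L 0 x z ↔ z = x := by
  constructor
  · intro h
    funext i
    have hi := h i
    simp only [ctrShift, pow_zero, one_mul] at hi
    omega
  · rintro rfl i
    simp [ctrShift]

/-- Depth `1`: `z ∈ B¹(y) ↔ z ∈ B(L•y)` (the centred block `InBlock` of `B8Lemma1NonAbelianRecLoops`), odd `L`. [cite: Balaban1987RG1, (0.3) p.252 (bookkeeping)] -/
theorem underZ_one_iff_inBlock {L s : ℕ} (hL : L = 2 * s + 1) (y z : Site d) : UnderZ L 1 y z ↔ InBlock L ((L : ℤ) • y) z := by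
  rw [inBlock_iff hL]
  have hs : ctrShift L 1 = s := by unfold ctrShift; rw [pow_one]; omega
  simp only [UnderZ, hs, pow_one, Pi.smul_apply, smul_eq_mul]

/-- `L•y + offZ L r ∈ B¹(y)`. [cite: Balaban1987RG1, (0.3) p.252 (bookkeeping)] -/
theorem underZ_one_block {L s : ℕ} (hL : L = 2 * s + 1) (y : Site d) (r : Fin d → Fin L) : UnderZ L 1 y ((L : ℤ) • y + offZ L r) :=
  (underZ_one_iff_inBlock hL y _).mpr ⟨r, rfl⟩

/-- The centre: `L•y ∈ B¹(y)`. [cite: Balaban1987RG1, (0.3) p.252 (bookkeeping)] -/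
theorem underZ_one_centre (L : ℕ) (y : Site d) : UnderZ L 1 y ((L : ℤ) • y) := by
  intro i
  have h0 : (0 : ℤ) ≤ (ctrShift L 1 : ℤ) := by positivity
  simp only [Pi.smul_apply, smul_eq_mul, pow_one, sub_self]
  exact ⟨by linarith, h0⟩

/-- Composition of depths: `z ∈ Bᵐ(x)`, `x ∈ B¹(y)` ⇒ `z ∈ B^{m+1}(y)` (odd `L`: `ctrShift L (m+1) = L·ctrShift L m + (L−1)∕2`... here via `Lᵐ·s + s_m`).
[cite: Balaban1985RegularSpaces, p.79 («x_n ∈ B(x_{n+1}), n = 0, 1, …, j − 1»)] -/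
theorem underZ_succ_of_underZ_block {L : ℕ} (hL : Odd L) {m : ℕ} {y x z : Site d} (hx : UnderZ L 1 y x) (hz : UnderZ L m x z) :
    UnderZ L (m + 1) y z := by
  intro i
  obtain ⟨h1, h2⟩ := hx i
  obtain ⟨h3, h4⟩ := hz i
  rw [pow_one] at h1 h2
  have hL0 : (0 : ℤ) ≤ (L : ℤ) ^ m := by positivity
  -- `ctrShift L (m+1) = Lᵐ·ctrShift L 1 + ctrShift L m`
  have hc1 : 2 * (ctrShift L 1 : ℤ) + 1 = L := by have := two_mul_ctrShift_add_one hL 1; rw [pow_one] at this; exact_mod_cast this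
  have hcm : 2 * (ctrShift L m : ℤ) + 1 = (L : ℤ) ^ m := by exact_mod_cast two_mul_ctrShift_add_one hL m
  have hcm1 : 2 * (ctrShift L (m + 1) : ℤ) + 1 = (L : ℤ) ^ (m + 1) := by exact_mod_cast two_mul_ctrShift_add_one hL (m + 1)
  have key : (ctrShift L (m + 1) : ℤ) = (L : ℤ) ^ m * ctrShift L 1 + ctrShift L m := by
    have : (L : ℤ) ^ (m + 1) = (L : ℤ) ^ m * L := pow_succ _ _
    nlinarith
  have h5 := mul_le_mul_of_nonneg_left h1 hL0
  have h6 := mul_le_mul_of_nonneg_left h2 hL0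
  rw [key, pow_succ]
  constructor <;> nlinarith

/-- **Descent in the CENTRED tower**: if `x` lies in the depth-`m₀` cube `[tlo m₀, thi m₀]` of `B8Ineq130Rec` then every `z ∈ Bᵐ(x)` lies in the depth-`(m₀ + m)`
cube. [cite: Balaban1985RegularSpaces, p.98 («for every j the cube □_j is a sum of the big blocks»); Balaban1987RG1, (0.3) p.252] -/
theorem underZ_tower {L : ℕ} (hL : Odd L) {lo hi : Site d} {m₀ m : ℕ} {x z : Site d} (hx : tlo L lo m₀ ≤ x) (hx' : x ≤ thi L hi m₀)
    (hz : UnderZ L m x z) : tlo L lo (m₀ + m) ≤ z ∧ z ≤ thi L hi (m₀ + m) := by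
  have hL0 : (0 : ℤ) ≤ (L : ℤ) ^ m := by positivity
  have hcm : 2 * (ctrShift L m : ℤ) + 1 = (L : ℤ) ^ m := by exact_mod_cast two_mul_ctrShift_add_one hL m
  have hc0 : 2 * (ctrShift L m₀ : ℤ) + 1 = (L : ℤ) ^ m₀ := by exact_mod_cast two_mul_ctrShift_add_one hL m₀
  have hcs : 2 * (ctrShift L (m₀ + m) : ℤ) + 1 = (L : ℤ) ^ (m₀ + m) := by exact_mod_cast two_mul_ctrShift_add_one hL (m₀ + m)
  have key : (ctrShift L (m₀ + m) : ℤ) = (L : ℤ) ^ m * ctrShift L m₀ + ctrShift L m := by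
    have : (L : ℤ) ^ (m₀ + m) = (L : ℤ) ^ m * (L : ℤ) ^ m₀ := by rw [pow_add, mul_comm]
    nlinarith
  constructor <;> intro i
  · have h1 : tlo L lo m₀ i ≤ x i := hx i
    rw [tlo_apply hL] at h1 ⊢
    have h2 := mul_le_mul_of_nonneg_left h1 hL0
    have h3 := (hz i).1
    rw [key, pow_add]
    nlinarith
  · have h1 : x i ≤ thi L hi m₀ i := hx' i
    rw [thi_apply hL] at h1 ⊢
    have h2 := mul_le_mul_of_nonneg_left h1 hL0
    have h3 := (hz i).2
    rw [key, pow_add]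
    nlinarith

/-! ## §1b Centred floors: the `Lᵐ`-block of a fine site, the `j`-fold one-step floor, the centred block Finsets at scale `Lʲ` -/

/-- `ctrShift L (n + p) = Lᵖ·ctrShift L n + ctrShift L p` (odd `L`): the half-widths of nested centred blocks. [cite: Balaban1987RG1, (0.3) p.252 (bookkeeping)] -/
theorem ctrShift_add {L : ℕ} (hL : Odd L) (n p : ℕ) : (ctrShift L (n + p) : ℤ) = (L : ℤ) ^ p * ctrShift L n + ctrShift L p := by
  have hcn : 2 * (ctrShift L n : ℤ) + 1 = (L : ℤ) ^ n := by exact_mod_cast two_mul_ctrShift_add_one hL n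
  have hcp : 2 * (ctrShift L p : ℤ) + 1 = (L : ℤ) ^ p := by exact_mod_cast two_mul_ctrShift_add_one hL p
  have hcs : 2 * (ctrShift L (n + p) : ℤ) + 1 = (L : ℤ) ^ (n + p) := by exact_mod_cast two_mul_ctrShift_add_one hL (n + p)
  have : (L : ℤ) ^ (n + p) = (L : ℤ) ^ p * (L : ℤ) ^ n := by rw [pow_add, mul_comm]
  nlinarith

/-- `ctrShift L 0 = 0`. [cite: Balaban1987RG1, (0.3) p.252 (bookkeeping)] -/
@[simp] theorem ctrShift_zero (L : ℕ) : ctrShift L 0 = 0 := by simp [ctrShift]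

/-- `ctrShift L 1 = (L − 1)∕2`. [cite: Balaban1987RG1, (0.3) p.252 (bookkeeping)] -/
theorem ctrShift_one (L : ℕ) : ctrShift L 1 = (L - 1) / 2 := by simp [ctrShift]

/-- The coarse site whose CENTRED `Lᵐ`-block contains a fine site: `⌊(x + cₘ)∕Lᵐ⌋`, `cₘ = ctrShift L m` (engine: `B8Eq131Cubes.flm`, corner blocks).
[cite: Balaban1987RG1, (0.3) p.252] -/
def flmZ (L m : ℕ) (x : Site d) : Site d := fun i => (x i + ctrShift L m) / (L : ℤ) ^ m

/-- Depth `0`: `flmZ L 0 = id`. [cite: Balaban1987RG1, (0.3) p.252 (bookkeeping)] -/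
@[simp] theorem flmZ_zero (L : ℕ) (x : Site d) : flmZ L 0 x = x := by
  funext i; simp [flmZ]

/-- `x ∈ Bᵐ(flmZ x)` (odd `L`). [cite: Balaban1987RG1, (0.3) p.252] -/
theorem underZ_flmZ {L : ℕ} (hL : Odd L) (m : ℕ) (x : Site d) : UnderZ L m (flmZ L m x) x := by
  intro i
  have hLpos : (0 : ℤ) < (L : ℤ) ^ m := by have := hL.pos; positivity
  have hc : 2 * (ctrShift L m : ℤ) + 1 = (L : ℤ) ^ m := by exact_mod_cast two_mul_ctrShift_add_one hL m
  have h1 : (x i + ctrShift L m) % (L : ℤ) ^ m + (x i + ctrShift L m) / (L : ℤ) ^ m * (L : ℤ) ^ m = x i + ctrShift L m :=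
    Int.emod_add_ediv_mul _ _
  have h2 := Int.emod_nonneg (x i + ctrShift L m) hLpos.ne'
  have h3 := Int.emod_lt_of_pos (x i + ctrShift L m) hLpos
  simp only [flmZ]
  constructor <;> linarith

/-- **The centred block of a fine site is unique**: `x ∈ Bᵐ(y) ↔ flmZ L m x = y` (odd `L`). [cite: Balaban1987RG1, (0.3) p.252] -/
theorem underZ_iff_flmZ_eq {L : ℕ} (hL : Odd L) (m : ℕ) (y x : Site d) : UnderZ L m y x ↔ flmZ L m x = y := by
  have hLpos : (0 : ℤ) < (L : ℤ) ^ m := by have := hL.pos; positivity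
  have hc : 2 * (ctrShift L m : ℤ) + 1 = (L : ℤ) ^ m := by exact_mod_cast two_mul_ctrShift_add_one hL m
  constructor
  · intro h
    funext i
    obtain ⟨h1, h2⟩ := h i
    obtain ⟨h3, h4⟩ := underZ_flmZ hL m x i
    -- `Lᵐ·|flmZ x − y| ≤ 2cₘ < Lᵐ`
    have h5 : (L : ℤ) ^ m * (flmZ L m x i - y i) < (L : ℤ) ^ m * 1 := by linarith
    have h6 : (L : ℤ) ^ m * (y i - flmZ L m x i) < (L : ℤ) ^ m * 1 := by linarith
    have h7 := lt_of_mul_lt_mul_left h5 hLpos.le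
    have h8 := lt_of_mul_lt_mul_left h6 hLpos.le
    omega
  · rintro rfl
    exact underZ_flmZ hL m x

/-- The one-step centred floor `B8Ineq130Rec.fl` is `flmZ L 1` (odd `L`). [cite: Balaban1987RG1, (0.3) p.252 (bookkeeping)] -/
theorem fl_eq_flmZ_one (L : ℕ) (x : Site d) : fl L x = flmZ L 1 x := by
  funext i
  simp [fl, B8Ineq130.fl, flmZ, halfVec, ctrShift_one]

/-- **Nested centred blocks**: the `j`-fold one-step floor is the `Lʲ`-floor, `(fl L)^[j] = flmZ L j` (odd `L`; `c_{j+1} = L·c_j + c₁`).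
[cite: Balaban1987RG1, (0.3) p.252; Balaban1985Averaging, (3) p.17] -/
theorem iterate_fl_eq_flmZ {L : ℕ} (hL : Odd L) : ∀ (j : ℕ) (x : Site d), (fl L)^[j] x = flmZ L j x
  | 0, x => by funext i; simp [flmZ]
  | j + 1, x => by
    rw [Function.iterate_succ_apply, iterate_fl_eq_flmZ hL j (fl L x), fl_eq_flmZ_one]
    funext i
    have hL0 : (0 : ℤ) < (L : ℤ) := by exact_mod_cast hL.pos
    have hc : (ctrShift L (j + 1) : ℤ) = (L : ℤ) * ctrShift L j + ctrShift L 1 := by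
      have h := ctrShift_add hL j 1
      rw [pow_one] at h
      rw [h]
    simp only [flmZ, pow_one]
    rw [hc, show x i + ((L : ℤ) * ctrShift L j + ctrShift L 1) = x i + ctrShift L 1 + ctrShift L j * L by ring,
      ← Int.add_mul_ediv_right _ _ hL0.ne', Int.ediv_ediv_of_nonneg hL0.le, pow_succ']

/-- **The centred `Lʲ`-block Finset** (dag-n05-e's `blockSitesZ` at the odd scale `Lʲ`) **is `Bʲ(y)`**: `x ∈ blockSitesZ (Lʲ) y ↔ x ∈ Bʲ(y)` (odd `L`).
[cite: Balaban1987RG1, (0.3) p.252; Balaban1985Averaging, (3) p.17] -/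
theorem mem_blockSitesZ_pow_iff {L : ℕ} (hL : Odd L) (j : ℕ) (y x : Site d) :
    x ∈ B7SectEFLinearisationRec.blockSitesZ (L ^ j) y ↔ UnderZ L j y x := by
  have hN : L ^ j = 2 * ctrShift L j + 1 := (two_mul_ctrShift_add_one hL j).symm
  rw [B7SectEFLinearisationRec.mem_blockSitesZ]
  have h1 : (∃ r : Fin d → Fin (L ^ j), x = ((L ^ j : ℕ) : ℤ) • y + offZ (L ^ j) r) ↔ InBlock (L ^ j) (((L ^ j : ℕ) : ℤ) • y) x :=
    Iff.rfl
  rw [h1, inBlock_iff hN]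
  simp only [UnderZ, Pi.smul_apply, smul_eq_mul, Nat.cast_pow]

/-- Hence `x ∈ blockSitesZ (Lʲ) y ↔ flmZ L j x = y` (odd `L`). [cite: Balaban1987RG1, (0.3) p.252 (bookkeeping)] -/
theorem mem_blockSitesZ_pow_iff_flmZ {L : ℕ} (hL : Odd L) (j : ℕ) (y x : Site d) :
    x ∈ B7SectEFLinearisationRec.blockSitesZ (L ^ j) y ↔ flmZ L j x = y := by
  rw [mem_blockSitesZ_pow_iff hL, underZ_iff_flmZ_eq hL]

/-! ## §2 `Ax_k(ℭ, 1)` — (1.15) below the constraint sets, record tower -/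

section Classes

variable {𝔸 : Type*} [NormedRing 𝔸] [NormedAlgebra ℂ 𝔸] [CompleteSpace 𝔸]

/-- **`W ∈ Ax_k(ℭ, 1)`, RECORD TOWER** — (1.15)∕(1.132)'s axial class: for every `x_j ∈ Λ_j`, `1 ≤ j ≤ k`, every `n < j` and every `z ∈ B^{j−n−1}(x_j)` (centred), the
record average `W̄ⁿ = avgIterZ L W n` has trivial transporters along the block contours from the CENTRE `L•z`: `W̄ⁿ(Γ_{L•z, L•z+offZ L r}) = 1` — the twin of
`B8Ineq132.InAxOne`. [cite: Balaban1985RegularSpaces, (1.15) p.78, (1.132) p.99; Balaban1987RG1, (0.3) p.252] -/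
def InAxOneZ (L k : ℕ) (Λ : ℕ → Set (Site d)) (W : Site d → Fin d → 𝔸ˣ) : Prop :=
  ∀ j, 1 ≤ j → j ≤ k → ∀ xj ∈ Λ j, ∀ n, n < j → ∀ z : Site d, UnderZ L (j - (n + 1)) xj z →
    ∀ r : Fin d → Fin L, axialFn (avgIterZ L W n) ((L : ℤ) • z) ((L : ℤ) • z + offZ L r) = 1

/-- **(1.15) on the CENTRED tower of cubes gives `Ax_k(ℭ, 1)`** for every `ℭ` whose level-`j` pieces lie in the depth-`(k − j)` cube `□̃^{(j)} = [tlo (k − j), thi (k − j)]`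
(odd `L`). [cite: Balaban1985RegularSpaces, (1.132) p.99 (Ax-part), (1.15) p.78] -/
theorem inAxOneZ_of_tower {L : ℕ} (hL : Odd L) {lo hi : Site d} {k : ℕ} {W : Site d → Fin d → 𝔸ˣ}
    (h15 : ∀ n, n < k → ∀ z, tlo L lo n ≤ z → z ≤ thi L hi n → ∀ r : Fin d → Fin L,
      axialFn (avgIterZ L W (k - (n + 1))) ((L : ℤ) • z) ((L : ℤ) • z + offZ L r) = 1)
    {Λ : ℕ → Set (Site d)}
    (hΛ : ∀ j, 1 ≤ j → j ≤ k → ∀ x ∈ Λ j, tlo L lo (k - j) ≤ x ∧ x ≤ thi L hi (k - j)) :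
    InAxOneZ L k Λ W := by
  intro j hj1 hjk xj hxj n hn z hz r
  obtain ⟨hx, hx'⟩ := hΛ j hj1 hjk xj hxj
  obtain ⟨hz1, hz2⟩ := underZ_tower hL hx hx' hz
  have hdepth : k - j + (j - (n + 1)) = k - (n + 1) := by omega
  rw [hdepth] at hz1 hz2
  have h := h15 (k - (n + 1)) (by omega) z hz1 hz2 r
  rwa [show k - (k - (n + 1) + 1) = n by omega] at h

/-! ## §3 `Ax_k(ℭ, U₀)` — (1.19) relative to a background, record tower, TRANSPORTER FORM -/

/-- **`W ∈ Ax_k(ℭ, U₀)`, RECORD TOWER, (1.19) IN TRANSPORTER FORM** (POINT 2): for every `x_j ∈ Λ_j`, `1 ≤ j ≤ k`, `n < j`, `z ∈ B^{j−n−1}(x_j)` (centred) and every point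
`L•z + offZ L r` of the centred block: `W̄ⁿ(Γ_{L•z,x}) = Ū₀ⁿ(Γ_{L•z,x})` for the record averages — equivalent in the engine to the printed product (1.19)
(`B8Eq119TwistedAxial.inAx_iff`); the twin of `B8Eq119TwistedAxial.InAx`. [cite: Balaban1985RegularSpaces, (1.19)–(1.20) p.79; Balaban1987RG1, (0.4) p.253] -/
def InAxZ (L k : ℕ) (Λ : ℕ → Set (Site d)) (U₀ W : Site d → Fin d → 𝔸ˣ) : Prop :=
  ∀ j, 1 ≤ j → j ≤ k → ∀ xj ∈ Λ j, ∀ n, n < j → ∀ z : Site d, UnderZ L (j - (n + 1)) xj z →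
    ∀ r : Fin d → Fin L,
      axialFn (avgIterZ L W n) ((L : ℤ) • z) ((L : ℤ) • z + offZ L r) =
        axialFn (avgIterZ L U₀ n) ((L : ℤ) • z) ((L : ℤ) • z + offZ L r)

/-- **(1.19) ⟺ `W̄ⁿ(Γ_{x_{n+1},x_n}) = Ū₀ⁿ(Γ_{x_{n+1},x_n})`** — here the DEFINITION (`Iff.rfl`; engine `inAx_iff`). [cite: Balaban1985RegularSpaces, (1.19) p.79] -/
theorem inAxZ_iff (L k : ℕ) (Λ : ℕ → Set (Site d)) (U₀ W : Site d → Fin d → 𝔸ˣ) :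
    InAxZ L k Λ U₀ W ↔
      ∀ j, 1 ≤ j → j ≤ k → ∀ xj ∈ Λ j, ∀ n, n < j → ∀ z : Site d, UnderZ L (j - (n + 1)) xj z →
        ∀ r : Fin d → Fin L,
          axialFn (avgIterZ L W n) ((L : ℤ) • z) ((L : ℤ) • z + offZ L r) =
            axialFn (avgIterZ L U₀ n) ((L : ℤ) • z) ((L : ℤ) • z + offZ L r) := Iff.rfl

/-- **`Ax_k(ℭ, 1)` IS (1.15)** for the record tower (`1̄ⁿ = 1`, `BlockAveragingZd.avgIterZ_one`). [cite: Balaban1985RegularSpaces, (1.15) p.78, (1.19) p.79, (1.132) p.99] -/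
theorem inAxZ_one_iff (L k : ℕ) (Λ : ℕ → Set (Site d)) (W : Site d → Fin d → 𝔸ˣ) :
    InAxZ L k Λ (1 : Site d → Fin d → 𝔸ˣ) W ↔ InAxOneZ L k Λ W := by
  simp only [InAxZ, InAxOneZ, avgIterZ_one, axialFn_one]

/-- The background is on its own gauge surface: `U₀ ∈ Ax_k(ℭ, U₀)`. [cite: Balaban1985RegularSpaces, p.78 («the surfaces pass through the element U₀»), (1.19) p.79] -/
theorem inAxZ_self (L k : ℕ) (Λ : ℕ → Set (Site d)) (U₀ : Site d → Fin d → 𝔸ˣ) : InAxZ L k Λ U₀ U₀ :=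
  fun _ _ _ _ _ _ _ _ _ _ => rfl

/-- (1.19) between ALL consecutive levels at every centred block of `ℤᵈ` gives `W ∈ Ax_k(ℭ, U₀)` for every `ℭ`. [cite: Balaban1985RegularSpaces, (1.19) p.79] -/
theorem inAxZ_of_global {L k : ℕ} {U₀ W : Site d → Fin d → 𝔸ˣ}
    (h19 : ∀ n, n < k → ∀ (z : Site d) (r : Fin d → Fin L),
      axialFn (avgIterZ L W (k - (n + 1))) ((L : ℤ) • z) ((L : ℤ) • z + offZ L r) =
        axialFn (avgIterZ L U₀ (k - (n + 1))) ((L : ℤ) • z) ((L : ℤ) • z + offZ L r))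
    (Λ : ℕ → Set (Site d)) : InAxZ L k Λ U₀ W := by
  intro j _ hjk xj _ n hn z _ r
  have h := h19 (k - (n + 1)) (by omega) z r
  rwa [show k - (k - (n + 1) + 1) = n by omega] at h

/-- (1.19) on the CENTRED tower of cubes gives `Ax_k(ℭ, U₀)` for every `ℭ` whose level-`j` pieces lie in `□̃^{(j)}` (odd `L`).
[cite: Balaban1985RegularSpaces, (1.19) p.79, (1.131)–(1.132) p.99] -/
theorem inAxZ_of_tower {L : ℕ} (hL : Odd L) {lo hi : Site d} {k : ℕ} {U₀ W : Site d → Fin d → 𝔸ˣ}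
    (h19 : ∀ n, n < k → ∀ z, tlo L lo n ≤ z → z ≤ thi L hi n → ∀ r : Fin d → Fin L,
      axialFn (avgIterZ L W (k - (n + 1))) ((L : ℤ) • z) ((L : ℤ) • z + offZ L r) =
        axialFn (avgIterZ L U₀ (k - (n + 1))) ((L : ℤ) • z) ((L : ℤ) • z + offZ L r))
    {Λ : ℕ → Set (Site d)}
    (hΛ : ∀ j, 1 ≤ j → j ≤ k → ∀ x ∈ Λ j, tlo L lo (k - j) ≤ x ∧ x ≤ thi L hi (k - j)) :
    InAxZ L k Λ U₀ W := by
  intro j hj1 hjk xj hxj n hn z hz r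
  obtain ⟨hx, hx'⟩ := hΛ j hj1 hjk xj hxj
  obtain ⟨hz1, hz2⟩ := underZ_tower hL hx hx' hz
  have hdepth : k - j + (j - (n + 1)) = k - (n + 1) := by omega
  rw [hdepth] at hz1 hz2
  have h := h19 (k - (n + 1)) (by omega) z hz1 hz2 r
  rwa [show k - (k - (n + 1) + 1) = n by omega] at h

/-! ## §4 (1.29) «`(R̄₀uʲ)(y) = 1` for `y ∈ Λ_j`» for the record: [3] (79)–(80) over the centred `Blocking` with the transporters from the centre -/

/-- For the trivial background all record transporters are `1`. [cite: Balaban1985Averaging, (78)–(80) p.30 (bookkeeping)] -/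
theorem bgTZ_one (L : ℕ) : bgTZ L (1 : Site d → Fin d → 𝔸ˣ) = fun _ _ _ => 1 := by
  funext j y x
  rw [bgTZ_apply, avgIterZ_one, axialFn_one]

/-- **(1.29) TYPED FOR THE RECORD**: «`(R̄₀uʲ)(y) = 1` for `y ∈ Λ_j`, `j = 0, 1, …, k`» — `R̄₀uʲ` the `j`-th order averaging operation (79)–(80) of [3] for gauge transformations
over the CENTRED blocking `zdBlockingZ d L` (blocks `L•y + offZ`, base point `L•y`, weights `L⁻ᵈ`; dag-n05-e's `B7SectEFLinearisationRec` §9), with the background transporters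
`bgTZ L U₀` from the centres; the twin of `B8Eq119TwistedAxial.Restr129`. [cite: Balaban1985RegularSpaces, (1.29) p.81; Balaban1985Averaging, (78)–(80) p.30; Balaban1987RG1, (0.3) p.252] -/
def Restr129Z (L k : ℕ) (Λ : ℕ → Set (Site d)) (U₀ : Site d → Fin d → 𝔸ˣ) (u : Site d → 𝔸ˣ) : Prop :=
  ∀ j, j ≤ k → ∀ y ∈ Λ j, Rbar (zdBlockingZ d L) (bgTZ L U₀) j (fun x => ((u x : 𝔸ˣ) : 𝔸)) y = 1

/-- (1.29) at `j = 0` reads `u(y) = 1` for `y ∈ Λ₀` (`R̄₀u⁰ = u`) — (1.14) on `Λ₀`. [cite: Balaban1985RegularSpaces, (1.29) p.81, (1.14) p.78] -/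
theorem restr129Z_level_zero {L k : ℕ} {Λ : ℕ → Set (Site d)} {U₀ : Site d → Fin d → 𝔸ˣ} {u : Site d → 𝔸ˣ}
    (h : Restr129Z L k Λ U₀ u) {y : Site d} (hy : y ∈ Λ 0) : ((u y : 𝔸ˣ) : 𝔸) = 1 := by
  have h0 := h 0 (Nat.zero_le _) y hy
  rwa [Rbar_zero] at h0

/-- (1.29) relative to the trivial background is the condition on the PLAIN record averages of (78) (all transporters `1`).
[cite: Balaban1985RegularSpaces, (1.29) p.81] -/
theorem restr129Z_one_iff (L k : ℕ) (Λ : ℕ → Set (Site d)) (u : Site d → 𝔸ˣ) :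
    Restr129Z L k Λ (1 : Site d → Fin d → 𝔸ˣ) u ↔
      ∀ j, j ≤ k → ∀ y ∈ Λ j, Rbar (zdBlockingZ d L) (fun _ _ _ => (1 : 𝔸ˣ)) j (fun x => ((u x : 𝔸ˣ) : 𝔸)) y = 1 := by
  simp only [Restr129Z, bgTZ_one]

end Classes

end Literature.MathematicalPhysics.QuantumFieldTheory.Balaban1983to89.B8Eq119TwistedAxialRec
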